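import Summits.CriticalPhenomena.PercolationContinuityZ3.Theorems.SahiMasterFamilyKahnModulePeelable
import Literature.Combinatorics.Sahi2008.FKG
import Literature.Combinatorics.Sahi2008.Percolation
import Mathlib.Order.Hom.Set

/-!
# Kahn's inequality for peelable pairs — the bridge to the tree's vocabulary (`sahiE3 (prodBernoulli p)`)
# (lineage `prim-master-conj`, gen 55; `--supports stmt-CriticalPhenomena-4575`)

Connects the weighted-preorder framework of `…SahiMasterFamilyKahnModule{Prelim,,OrOr,Peelable}` with the Literature:

* `ex` and `kahnK` ARE Sahi's `E` and `E₃`: `ex_eq_sahi_ex`, `kahnK_eq_sahiE_three`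
  (`Literature.Combinatorics.Sahi2008.{ex, sahiE}`);
* every FKG probability weight on a finite distributive lattice is a Harris space in our sense
  (`isHarris_of_isFKGMeasure`, from the tree's `ex_mul_ex_le_ex_mul` = Mathlib's `fkg`, by shifting monotone functions to
  nonnegative ones); in particular the product weight `bernoulliWeight p` on the Boolean lattice `Set ι`
  (`isProbWeight_bernoulliWeight`, `isHarris_bernoulliWeight`);
* **`sahiE3_nonneg_of_kahnPair`**: a Kahn pair `(1_B, 1_C)` for `bernoulliWeight p` gives Kahn's inequality
  `0 ≤ sahiE3 (prodBernoulli p) A B C` for EVERY increasing event `A` — the conclusion of the open obligation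
  `KahnConjecture` (…Theorems/SahiConjecture.lean) for these triples;
* transport of Kahn pairs along order isomorphisms (`kahnPair_comp_orderIso`) and the splitting of the product weight along
  `Set.sumEquiv : Set (S ⊕ T) ≃o Set S × Set T` (`bernoulliWeight_eq_prodW_comp_sumEquiv`), so that the module-extension
  theorems (stated on product types) apply to events of `Set (S ⊕ T)`: `kahnPair_bernoulliWeight_sum_of_kahnPair_prod`.

Nothing here asserts Kahn's Conjecture 5; `Peelable.kahnPair` + this file prove it for jointly module-peelable `(B,C)`.
[this work]
-/

open Finset
open scoped BigOperators

namespace Summit.CriticalPhenomena.PercolationContinuityZ3.Theorems.SahiKahnModule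

open Literature.Combinatorics.Sahi2008 (sahiE sahiE_three IsFKGMeasure ex_mul_ex_le_ex_mul bernoulliWeight
  isFKGMeasure_bernoulliWeight sahiE_three_ind monotone_ind_of_isUpperSet)
open Literature.Probability.LatticeModels (prodBernoulli sahiE3)
open Literature.Probability.Percolation.DecisionTree (ind ind_of_mem ind_of_not_mem ind_nonneg)

universe u

section Identification
variable {α : Type*} [Fintype α]

/-- Our `ex` is Sahi's expectation `E` (`Literature.Combinatorics.Sahi2008.ex`), definitionally. [this work] -/
theorem ex_eq_sahi_ex (μ f : α → ℝ) : ex μ f = Literature.Combinatorics.Sahi2008.ex μ f := rfl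

/-- Our `kahnK` is Sahi's `E₃` [Sahi 2008, p. 213; Lieb–Sahi 2021, eq. (2.1)]. [this work] -/
theorem kahnK_eq_sahiE_three (μ f g h : α → ℝ) : kahnK μ f g h = sahiE μ 3 ![f, g, h] := by
  rw [sahiE_three]; unfold kahnK; simp only [ex_eq_sahi_ex]; ring

/-- An FKG probability weight is a probability weight. [this work] -/
theorem isProbWeight_of_isFKGMeasure [Lattice α] {μ : α → ℝ} (hμ : IsFKGMeasure μ) : IsProbWeight μ :=
  ⟨hμ.nonneg, hμ.sum_eq_one⟩

/-- **FKG ⇒ Harris** in our sense: on a finite distributive lattice with an FKG probability weight,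
`E f · E g ≤ E(fg)` for ALL monotone `f, g` (the tree's `ex_mul_ex_le_ex_mul` = Mathlib's `fkg` for nonnegative monotone
functions, applied to `f + M_f`, `g + M_g`). [this work] -/
theorem isHarris_of_isFKGMeasure [DistribLattice α] {μ : α → ℝ} (hμ : IsFKGMeasure μ) : IsHarris μ := by
  intro f g hf hg
  set Mf : ℝ := ∑ x, |f x| with hMf
  set Mg : ℝ := ∑ x, |g x| with hMg
  have hf0 : ∀ x, 0 ≤ f x + Mf := fun x => by
    have h1 : |f x| ≤ Mf := Finset.single_le_sum (f := fun x => |f x|) (fun x _ => abs_nonneg _) (mem_univ x)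
    have h2 := neg_abs_le (f x)
    linarith
  have hg0 : ∀ x, 0 ≤ g x + Mg := fun x => by
    have h1 : |g x| ≤ Mg := Finset.single_le_sum (f := fun x => |g x|) (fun x _ => abs_nonneg _) (mem_univ x)
    have h2 := neg_abs_le (g x)
    linarith
  have key := ex_mul_ex_le_ex_mul hμ hf0 hg0 (fun a b hab => by simpa using hf hab) (fun a b hab => by simpa using hg hab)
  have hw : IsProbWeight μ := isProbWeight_of_isFKGMeasure hμ
  have e1 : Literature.Combinatorics.Sahi2008.ex μ (fun x => f x + Mf) = ex μ f + Mf := by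
    rw [← ex_eq_sahi_ex, show (fun x => f x + Mf) = f + fun _ => Mf from rfl, ex_add, ex_const hw]
  have e2 : Literature.Combinatorics.Sahi2008.ex μ (fun x => g x + Mg) = ex μ g + Mg := by
    rw [← ex_eq_sahi_ex, show (fun x => g x + Mg) = g + fun _ => Mg from rfl, ex_add, ex_const hw]
  have e3 : Literature.Combinatorics.Sahi2008.ex μ ((fun x => f x + Mf) * fun x => g x + Mg) =
      ex μ (f * g) + Mg * ex μ f + Mf * ex μ g + Mf * Mg := by
    rw [← ex_eq_sahi_ex, show ((fun x => f x + Mf) * fun x => g x + Mg) =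
      f * g + ((fun x => Mg * f x) + ((fun x => Mf * g x) + fun _ => Mf * Mg)) from by
        funext x; simp only [Pi.mul_apply, Pi.add_apply]; ring]
    rw [ex_add, ex_add, ex_add, ex_smul, ex_smul, ex_const hw]; ring
  rw [e1, e2, e3] at key
  nlinarith [key]

end Identification

section Bernoulli
variable {ι : Type*} [Fintype ι]

/-- The product weight `bernoulliWeight p` on `Set ι` is a probability weight. [this work] -/
theorem isProbWeight_bernoulliWeight (p : ι → unitInterval) : IsProbWeight (bernoulliWeight p) :=
  isProbWeight_of_isFKGMeasure (isFKGMeasure_bernoulliWeight p)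

/-- **Harris' inequality for the product weight** on the Boolean lattice `Set ι`, in our sense. [this work] -/
theorem isHarris_bernoulliWeight (p : ι → unitInterval) : IsHarris (bernoulliWeight p) :=
  isHarris_of_isFKGMeasure (isFKGMeasure_bernoulliWeight p)

omit [Fintype ι] in
/-- The indicator of an event is an indicator function. [this work] -/
theorem isIndicator_ind (A : Set (Set ι)) : IsIndicator (ind A) := fun ω => by
  by_cases h : ω ∈ A
  · exact Or.inr (ind_of_mem h)
  · exact Or.inl (ind_of_not_mem h)

/-- **Kahn pairs give Kahn's inequality in the tree's vocabulary.**  If `(1_B, 1_C)` is a Kahn pair for the product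
weight `bernoulliWeight p`, then `0 ≤ sahiE3 (prodBernoulli p) A B C` for every increasing event `A` — the conclusion
of `KahnConjecture` for these triples (`E₃(1_A,1_B,1_C) = sahiE3 (prodBernoulli p) A B C`, tree lemma `sahiE_three_ind`).
[this work] -/
theorem sahiE3_nonneg_of_kahnPair (p : ι → unitInterval) {B C : Set (Set ι)}
    (hK : KahnPair (bernoulliWeight p) (ind B) (ind C)) {A : Set (Set ι)} (hA : IsUpperSet A) :
    0 ≤ sahiE3 (prodBernoulli p) A B C := by
  rw [← sahiE_three_ind, ← kahnK_eq_sahiE_three]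
  exact hK (ind A) (monotone_ind_of_isUpperSet hA) (ind_nonneg A)

/-- **Peelable pairs of events satisfy Kahn's Conjecture 5**: if `(1_B, 1_C)` is jointly module-peelable on
`(Set ι, bernoulliWeight p)` then `0 ≤ sahiE3 (prodBernoulli p) A B C` for every increasing `A`. [this work] -/
theorem sahiE3_nonneg_of_peelable (p : ι → unitInterval) {B C : Set (Set ι)}
    (hP : Peelable (Set ι) (bernoulliWeight p) (ind B) (ind C)) {A : Set (Set ι)} (hA : IsUpperSet A) :
    0 ≤ sahiE3 (prodBernoulli p) A B C :=
  sahiE3_nonneg_of_kahnPair p hP.kahnPair hA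

end Bernoulli

/-! ## Transport along order isomorphisms and splitting of the product weight -/

section Transport
variable {X X' : Type*} [Fintype X] [Fintype X']

/-- Reindexing an expectation along a bijection. [this work] -/
theorem ex_comp_bijective {e : X' → X} (he : Function.Bijective e) (w F : X → ℝ) : ex (w ∘ e) (F ∘ e) = ex w F := by
  unfold ex; exact Fintype.sum_bijective e he _ _ fun _ => rfl

/-- Reindexing `E₃` along a bijection. [this work] -/
theorem kahnK_comp_bijective {e : X' → X} (he : Function.Bijective e) (w f g h : X → ℝ) :
    kahnK (w ∘ e) (f ∘ e) (g ∘ e) (h ∘ e) = kahnK w f g h := by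
  unfold kahnK
  rw [show (f ∘ e) * (g ∘ e) * (h ∘ e) = (f * g * h) ∘ e from rfl, show (f ∘ e) * (g ∘ e) = (f * g) ∘ e from rfl,
    show (f ∘ e) * (h ∘ e) = (f * h) ∘ e from rfl, show (g ∘ e) * (h ∘ e) = (g * h) ∘ e from rfl]
  simp only [ex_comp_bijective he]

/-- **Kahn pairs transport along order isomorphisms** (with the weight transported too). [this work] -/
theorem kahnPair_comp_orderIso [Preorder X] [Preorder X'] (e : X' ≃o X) {w g h : X → ℝ} (hK : KahnPair w g h) :
    KahnPair (w ∘ e) (g ∘ e) (h ∘ e) := by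
  intro f' hf' hf'0
  have hf : f' = (f' ∘ e.symm) ∘ e := by funext x; simp
  rw [hf, kahnK_comp_bijective e.bijective]
  exact hK _ (hf'.comp e.symm.monotone) fun x => hf'0 _

/-- Probability weights transport along bijections. [this work] -/
theorem isProbWeight_comp_bijective {e : X' → X} (he : Function.Bijective e) {w : X → ℝ} (hw : IsProbWeight w) :
    IsProbWeight (w ∘ e) :=
  ⟨fun x => hw.nonneg _, by rw [show (∑ x, (w ∘ e) x) = ∑ x, w x from Fintype.sum_bijective e he _ _ fun _ => rfl]; exact hw.sum_one⟩

/-- Harris spaces transport along order isomorphisms. [this work] -/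
theorem isHarris_comp_orderIso [Preorder X] [Preorder X'] (e : X' ≃o X) {w : X → ℝ} (hH : IsHarris w) :
    IsHarris (w ∘ e) := by
  intro f' g' hf' hg'
  have hf : f' = (f' ∘ e.symm) ∘ e := by funext x; simp
  have hg : g' = (g' ∘ e.symm) ∘ e := by funext x; simp
  rw [hf, hg, show ((f' ∘ ⇑e.symm) ∘ ⇑e) * ((g' ∘ ⇑e.symm) ∘ ⇑e) = ((f' ∘ e.symm) * (g' ∘ e.symm)) ∘ e from rfl,
    ex_comp_bijective e.bijective, ex_comp_bijective e.bijective, ex_comp_bijective e.bijective]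
  exact hH _ _ (hf'.comp e.symm.monotone) (hg'.comp e.symm.monotone)

end Transport

section Splitting
variable {S T : Type*} [Fintype S] [Fintype T]

/-- **The product weight splits along `Set (S ⊕ T) ≃o Set S × Set T`**: `μ_p(ω) = μ_{p∘inl}(inl⁻¹ ω) · μ_{p∘inr}(inr⁻¹ ω)`.
[this work] -/
theorem bernoulliWeight_sum (p : S ⊕ T → unitInterval) (ω : Set (S ⊕ T)) :
    bernoulliWeight p ω = bernoulliWeight (p ∘ Sum.inl) (Sum.inl ⁻¹' ω) * bernoulliWeight (p ∘ Sum.inr) (Sum.inr ⁻¹' ω) := by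
  unfold bernoulliWeight Literature.Probability.Percolation.BHK2006.weight
  rw [Fintype.prod_sum_type]
  rfl

/-- The same, as an identity of functions through Mathlib's order isomorphism `Set.sumEquiv`. [this work] -/
theorem bernoulliWeight_eq_prodW_comp_sumEquiv (p : S ⊕ T → unitInterval) :
    bernoulliWeight p = prodW (bernoulliWeight (p ∘ Sum.inl)) (bernoulliWeight (p ∘ Sum.inr)) ∘ (Set.sumEquiv : Set (S ⊕ T) ≃o _) := by
  funext ω; rw [bernoulliWeight_sum]; rfl

/-- **From product types back to events of `Set (S ⊕ T)`.**  A Kahn pair `(g,h)` on `Set S × Set T` with the product of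
the two Bernoulli weights (e.g. produced by the module-extension theorems with `X = Set S`, `Y = Set T`) is a Kahn pair
`(g ∘ sumEquiv, h ∘ sumEquiv)` on `Set (S ⊕ T)` with the Bernoulli weight of `p`. [this work] -/
theorem kahnPair_bernoulliWeight_sum_of_kahnPair_prod (p : S ⊕ T → unitInterval) {g h : Set S × Set T → ℝ}
    (hK : KahnPair (prodW (bernoulliWeight (p ∘ Sum.inl)) (bernoulliWeight (p ∘ Sum.inr))) g h) :
    KahnPair (bernoulliWeight p) (g ∘ (Set.sumEquiv : Set (S ⊕ T) ≃o _)) (h ∘ (Set.sumEquiv : Set (S ⊕ T) ≃o _)) := by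
  rw [bernoulliWeight_eq_prodW_comp_sumEquiv]
  exact kahnPair_comp_orderIso _ hK

/-- **Worked instance in the tree's vocabulary**: for increasing events `B₀, C₀ ⊆ Set S` forming a Kahn pair for
`bernoulliWeight (p ∘ inl)` and an increasing event `V ⊆ Set T` (fresh coordinates), the events of `Set (S ⊕ T)`
`B = {ω | inl⁻¹ ω ∈ B₀ ∧ inr⁻¹ ω ∈ V}` ("`B₀ ∧ V`") and `C = {ω | inl⁻¹ ω ∈ C₀}` satisfy Kahn's inequality
`0 ≤ sahiE3 (prodBernoulli p) A B C` for every increasing `A`. [this work] -/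
theorem sahiE3_nonneg_and_left (p : S ⊕ T → unitInterval) {B₀ C₀ : Set (Set S)} {V : Set (Set T)}
    (hB₀ : IsUpperSet B₀) (hC₀ : IsUpperSet C₀) (hV : IsUpperSet V)
    (hK : KahnPair (bernoulliWeight (p ∘ Sum.inl)) (ind B₀) (ind C₀)) {A : Set (Set (S ⊕ T))} (hA : IsUpperSet A) :
    0 ≤ sahiE3 (prodBernoulli p) A {ω | Sum.inl ⁻¹' ω ∈ B₀ ∧ Sum.inr ⁻¹' ω ∈ V} {ω | Sum.inl ⁻¹' ω ∈ C₀} := by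
  have h1 := kahnPair_and_left (isProbWeight_bernoulliWeight (p ∘ Sum.inl)) (isProbWeight_bernoulliWeight (p ∘ Sum.inr))
    (isHarris_bernoulliWeight (p ∘ Sum.inl)) (isHarris_bernoulliWeight (p ∘ Sum.inr)) (isIndicator_ind B₀)
    (isIndicator_ind C₀) (monotone_ind_of_isUpperSet hB₀) (monotone_ind_of_isUpperSet hC₀) (monotone_ind_of_isUpperSet hV)
    (ind_nonneg V) hK
  have h2 := kahnPair_bernoulliWeight_sum_of_kahnPair_prod p h1
  have eB : (liftX (ind B₀) * liftY (ind V)) ∘ (Set.sumEquiv : Set (S ⊕ T) ≃o _) =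
      ind {ω : Set (S ⊕ T) | Sum.inl ⁻¹' ω ∈ B₀ ∧ Sum.inr ⁻¹' ω ∈ V} := by
    funext ω
    simp only [Function.comp_apply, Pi.mul_apply, liftX, liftY, Set.sumEquiv_apply]
    by_cases hb : Sum.inl ⁻¹' ω ∈ B₀ <;> by_cases hv : Sum.inr ⁻¹' ω ∈ V <;>
      simp [ind_of_mem, ind_of_not_mem, hb, hv]
  have eC : (liftX (ind C₀) : Set S × Set T → ℝ) ∘ (Set.sumEquiv : Set (S ⊕ T) ≃o _) =
      ind {ω : Set (S ⊕ T) | Sum.inl ⁻¹' ω ∈ C₀} := by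
    funext ω
    simp only [Function.comp_apply, liftX, Set.sumEquiv_apply]
    by_cases hc : Sum.inl ⁻¹' ω ∈ C₀ <;> simp [ind_of_mem, ind_of_not_mem, hc]
  rw [eB, eC] at h2
  exact sahiE3_nonneg_of_kahnPair p h2 hA

end Splitting

end Summit.CriticalPhenomena.PercolationContinuityZ3.Theorems.SahiKahnModule
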